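import Literature.MathematicalPhysics.QuantumLattice.MerminWagnerEquilibriumStates2D
import Literature.MathematicalPhysics.QuantumLattice.HubbardTTPrimeCanonicalStatesChargedRows
import Literature.MathematicalPhysics.QuantumLattice.HubbardWave0LiebProofs
import Literature.MathematicalPhysics.QuantumLattice.PairFieldMomentum
import HarnessLib

/-!
# No `U(1)` breaking in any translation-invariant equilibrium state of the two-dimensional `t–t'` Hubbard model at any temperature
# (Mermin–Wagner / Klein–Landau–Shucker for lattice fermions): every pair amplitude vanishes

Topic `Literature/MathematicalPhysics/QuantumLattice` (family `hubbard`; the model instance of `MerminWagnerEquilibriumStates2D`).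

**Klein–Landau–Shucker** (J. Stat. Phys. 26 (1981) 505) / **Koma–Tasaki** (PRL 68 (1992) 3248, for finite-volume Gibbs states of
Hubbard models, "absence of condensation of electron pairs"): at every temperature, no equilibrium state of a two-dimensional
lattice model with the `U(1)` particle-number symmetry breaks it. Here, for the grand-canonical `t–t'` Hubbard interaction
`gcInteractionTT' t t' U μ h` on `ℤ²` (nearest and next-nearest hopping, on-site `U`, chemical potential, Zeeman field — all
conserving the particle number AND the spin imbalance `N↑ − N↓`), every `β ≥ 0` and every translation-invariant state `ω` solving
the variational principle (in particular every `IsVarEquilibrium β (gcInteractionTT' …) 1` state):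

* `chargeSum_numberCharge` — the total on-site charge of `q = n_{0↑} + n_{0↓}` on a region is the particle number `N_Λ`;
  `chargeSum_spinCharge` — that of `q = n_{0↑} − n_{0↓}` is the spin imbalance `N↑_Λ − N↓_Λ`;
* `preservesSectors_gcInteractionTT'` — every term `Φ(Z)` of the interaction preserves the `(N↑, N↓)` sectors, hence
  `commute_chargeSum_numberCharge_gcInteractionTT'`, `commute_chargeSum_spinCharge_gcInteractionTT'` (conservation);
* `InfVolFermionState.IsTranslationInvariant.expect_eq_zero_of_numberCharged_ttPrime` — `ω(O) = 0` for every local `O` with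
  `N_Λ O − O N_Λ = κO`, `κ ≠ 0`; `…_of_spinCharged_ttPrime` — the same for the spin imbalance;
* `InfVolFermionState.IsTranslationInvariant.expect_annihilation_mul_annihilation_eq_zero_ttPrime` — EVERY PAIR AMPLITUDE VANISHES:
  `ω(c_p c_q) = 0` for all orbitals `p, q` of every finite region (charge `−2`), so no translation-invariant equilibrium state of the
  2D `t–t'` Hubbard model has a superconducting order parameter at any temperature; and the `IsVarEquilibrium` forms.

Everything is PROVED (standard axioms); two definitions (`numberCharge`, `spinCharge`), no named fact.

## Mathlib / tree search

REUSED: `IsTranslationInvariant.expect_eq_zero_of_conservedCharge_two` (`MerminWagnerEquilibriumStates2D`), `chargeAt`, `chargeSum`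
(`MerminWagnerCriterionEquilibriumStates`), `LiebThm1.preservesSectors_hopping`, `LiebThm1.preservesSectors_numberOp`,
`PreservesSectors.add/.smul/.sum/.mul/.ite/.commute_diagonal`, `LiebThm1.totalNumber_eq_diagonal`, `LiebThm1.spinZ_eq_diagonal`
(`HubbardWave0LiebProofs`, `HubbardLiebConfig`), `totalNumber_commutator_annihilation_mul_annihilation` (`PairFieldMomentum`),
`gcInteractionTT'_isHermitian/_isEven/_isTranslationInvariant/_hasFiniteRange` (`FermionGibbsVariationalPrinciple`), `fermionEmbed_numberOp`.

## References

* A. Klein, L. J. Landau, D. S. Shucker, J. Stat. Phys. 26 (1981) 505–512. [cite: KleinLandauShucker1981]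
* T. Koma, H. Tasaki, Phys. Rev. Lett. 68 (1992) 3248–3251 (no pair condensation in 1D/2D Hubbard models at `T > 0`).
  [cite: KomaTasakiPRL1992, p. 3]
* H. Araki, H. Moriya, Rev. Math. Phys. 15 (2003) 93, Thm. 12.11. [cite: ArakiMoriya2003, Theorem 12.11]
-/

noncomputable section

open scoped ComplexOrder BigOperators Matrix.Norms.L2Operator
open Finset Literature.InformationTheory.Entropy

namespace Literature.MathematicalPhysics.QuantumLattice

open Matrix Literature.Probability.LatticeModels ThermodynamicLimit LiebThm1
open _root_.Filter
open scoped _root_.Topology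

variable {d : ℕ}

/-! ### §1 The particle-number and spin-imbalance charges -/

/-- **The particle-number charge** `q = n_{0↑} + n_{0↓} ∈ 𝔄_{{0}}`. [cite: KleinLandauShucker1981] -/
def numberCharge (d : ℕ) : FermionOp ({0} : Finset (Site d)) :=
  nAt 0 (Finset.mem_singleton_self 0) 0 + nAt 0 (Finset.mem_singleton_self 0) 1

/-- **The spin-imbalance charge** `q = n_{0↑} − n_{0↓} ∈ 𝔄_{{0}}` (`2S^z_0`). [cite: KleinLandauShucker1981] -/
def spinCharge (d : ℕ) : FermionOp ({0} : Finset (Site d)) :=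
  nAt 0 (Finset.mem_singleton_self 0) 0 - nAt 0 (Finset.mem_singleton_self 0) 1

/-- `n_{xσ}` is Hermitian. [cite: Lieb1995] -/
private theorem nAt_isHermitian {Λ : Finset (Site d)} (x : Site d) (hx : x ∈ Λ) (σ : Fin 2) : (nAt x hx σ).IsHermitian := by
  rw [nAt, ← numberAt_orb]
  exact numberAt_isHermitian _

/-- `n_{xσ}` is even. [cite: ArakiMoriya2003, §4.1 Def. 4.5] -/
private theorem parityAut_nAt {Λ : Finset (Site d)} (x : Site d) (hx : x ∈ Λ) (σ : Fin 2) : parityAut (nAt x hx σ) = nAt x hx σ := by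
  rw [nAt, numberOp, map_mul, parityAut_creation, parityAut_annihilation, neg_mul_neg]

/-- The number charge is Hermitian. [cite: Lieb1995] -/
theorem numberCharge_isHermitian (d : ℕ) : (numberCharge d).IsHermitian :=
  (nAt_isHermitian _ _ 0).add (nAt_isHermitian _ _ 1)

/-- The number charge is even. [cite: ArakiMoriya2003, §4.1 Def. 4.5] -/
theorem parityAut_numberCharge (d : ℕ) : parityAut (numberCharge d) = numberCharge d := by
  rw [numberCharge, map_add, parityAut_nAt, parityAut_nAt]

/-- The spin charge is Hermitian. [cite: Lieb1995] -/
theorem spinCharge_isHermitian (d : ℕ) : (spinCharge d).IsHermitian :=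
  (nAt_isHermitian _ _ 0).sub (nAt_isHermitian _ _ 1)

/-- The spin charge is even. [cite: ArakiMoriya2003, §4.1 Def. 4.5] -/
theorem parityAut_spinCharge (d : ℕ) : parityAut (spinCharge d) = spinCharge d := by
  rw [spinCharge, map_sub, parityAut_nAt, parityAut_nAt]

/-- The translate of `n_{0σ}` to `x ∈ Λ` is `n_{xσ}`. [cite: ArakiMoriya2003, §4.1 Def. 4.3] -/
private theorem fermionEmbed_shift_incl_nAt {Λ : Finset (Site d)} {x : Site d} (hx : x ∈ Λ) (σ : Fin 2) :
    fermionEmbed ((PolySite.shiftEmb x {0}).trans (PolySite.incl (shiftSet_zero_singleton_subset hx)))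
      (nAt 0 (Finset.mem_singleton_self 0) σ) = nAt x hx σ := by
  rw [nAt, fermionEmbed_numberOp, nAt]
  congr 1
  apply Subtype.ext
  simp only [Function.Embedding.trans_apply, PolySite.shiftEmb_pt, PolySite.incl_pt]
  show toLex ((0 : Site d) + x) = toLex x
  rw [zero_add]

/-- **`q_x = n_{x↑} + n_{x↓}`** for the number charge. [cite: KleinLandauShucker1981] -/
theorem chargeAt_numberCharge {Λ : Finset (Site d)} {x : Site d} (hx : x ∈ Λ) :
    chargeAt (numberCharge d) Λ x = nAt x hx 0 + nAt x hx 1 := by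
  rw [chargeAt_of_mem _ hx, numberCharge, map_add, fermionEmbed_shift_incl_nAt, fermionEmbed_shift_incl_nAt]

/-- **`q_x = n_{x↑} − n_{x↓}`** for the spin charge. [cite: KleinLandauShucker1981] -/
theorem chargeAt_spinCharge {Λ : Finset (Site d)} {x : Site d} (hx : x ∈ Λ) :
    chargeAt (spinCharge d) Λ x = nAt x hx 0 - nAt x hx 1 := by
  rw [chargeAt_of_mem _ hx, spinCharge, map_sub, fermionEmbed_shift_incl_nAt, fermionEmbed_shift_incl_nAt]

/-- Reindexing a sum over the sites of `Λ` as a sum over the ordered sites. [cite: BratteliRobinsonII1997, §6.2.1] -/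
private theorem sum_attach_eq_sum_polySite' (Λ : Finset (Site d)) (F : PolySite Λ → FermionOp Λ) :
    ∑ x ∈ Λ.attach, F (PolySite.pt x.1 x.2) = ∑ y : PolySite Λ, F y := by
  classical
  let e : PolySite Λ ≃ {x // x ∈ Λ} :=
    ⟨fun a => ⟨ofLex a.1, PolySite.ofLex_mem a⟩, fun x => PolySite.pt x.1 x.2, fun a => PolySite.pt_ofLex a,
      fun x => Subtype.ext rfl⟩
  rw [← Finset.univ_eq_attach]
  exact (Fintype.sum_equiv e _ _ fun a => by
    rw [show PolySite.pt (e a).1 (e a).2 = e.symm (e a) from rfl, Equiv.symm_apply_apply]).symm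

/-- **`Q_Λ = N_Λ`**: the total number charge of a region is its particle number. [cite: KleinLandauShucker1981] -/
theorem chargeSum_numberCharge (Λ : Finset (Site d)) : chargeSum (numberCharge d) Λ = (totalNumber : FermionOp Λ) := by
  classical
  rw [chargeSum, totalNumber, ← sum_attach_eq_sum_polySite' Λ (fun y => ∑ σ : Fin 2, numberOp y σ), ← Finset.sum_attach Λ]
  refine Finset.sum_congr rfl fun x _ => ?_
  rw [chargeAt_numberCharge x.2, Fin.sum_univ_two]

/-- **`Q_Λ = N↑_Λ − N↓_Λ`** for the spin charge. [cite: KleinLandauShucker1981] -/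
theorem chargeSum_spinCharge (Λ : Finset (Site d)) : chargeSum (spinCharge d) Λ = (spinImbalance : FermionOp Λ) := by
  classical
  rw [chargeSum, spinImbalance, ← sum_attach_eq_sum_polySite' Λ (fun y => numberOp y 0 - numberOp y 1), ← Finset.sum_attach Λ]
  refine Finset.sum_congr rfl fun x _ => ?_
  rw [chargeAt_spinCharge x.2]

/-! ### §2 The interaction terms preserve the `(N↑, N↓)` sectors -/

/-- Differences of sector-preserving matrices preserve sectors. [cite: LiebPRL1989, eqs. (1)–(2)] -/
private theorem preservesSectors_sub {Λ : Type*} [LinearOrder Λ] [Fintype Λ] {M N : Matrix (Finset (Orb Λ)) (Finset (Orb Λ)) ℂ}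
    (hM : PreservesSectors M) (hN : PreservesSectors N) : PreservesSectors (M - N) := by
  rw [sub_eq_add_neg, ← neg_one_smul ℂ N]
  exact hM.add (hN.smul _)

/-- Every term of the nearest-neighbour Hubbard interaction preserves the sectors. [cite: LiebPRL1989, eqs. (1)–(2)] -/
theorem preservesSectors_hubbardFermionInteraction (t U : ℝ) (Z : Finset (Site d)) :
    PreservesSectors ((hubbardFermionInteraction d t U).Φ Z) := by
  unfold hubbardFermionInteraction
  simp only [cAt, annihilation_conjTranspose]
  refine PreservesSectors.add (PreservesSectors.sum fun x _ => ?_)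
    (PreservesSectors.sum fun x _ => PreservesSectors.sum fun y _ => ?_)
  · exact (((preservesSectors_numberOp _ 0).mul (preservesSectors_numberOp _ 1)).smul _).ite _
  · exact ((PreservesSectors.sum fun σ _ => (preservesSectors_hopping _ _ σ).add (preservesSectors_hopping _ _ σ)).smul _).ite _

/-- Every term of the diagonal hopping interaction preserves the sectors. [cite: LiebPRL1989, eqs. (1)–(2)] -/
theorem preservesSectors_diagHoppingFermionInteraction (t' : ℝ) (Z : Finset (Site 2)) :
    PreservesSectors ((diagHoppingFermionInteraction t').Φ Z) := by
  unfold diagHoppingFermionInteraction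
  simp only [cAt, annihilation_conjTranspose]
  exact PreservesSectors.sum fun x _ => PreservesSectors.sum fun y _ =>
    ((PreservesSectors.sum fun σ _ => (preservesSectors_hopping _ _ σ).add (preservesSectors_hopping _ _ σ)).smul _).ite _

/-- Every term of the particle-number interaction preserves the sectors. [cite: LiebPRL1989, eqs. (1)–(2)] -/
theorem preservesSectors_numberInteraction (Z : Finset (Site d)) : PreservesSectors ((numberInteraction d).Φ Z) := by
  unfold numberInteraction
  exact PreservesSectors.sum fun x _ => ((preservesSectors_numberOp _ 0).add (preservesSectors_numberOp _ 1)).ite _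

/-- Every term of the spin-imbalance interaction preserves the sectors. [cite: LiebPRL1989, eqs. (1)–(2)] -/
theorem preservesSectors_spinImbalanceInteraction (Z : Finset (Site d)) : PreservesSectors ((spinImbalanceInteraction d).Φ Z) := by
  unfold spinImbalanceInteraction
  exact PreservesSectors.sum fun x _ => (preservesSectors_sub (preservesSectors_numberOp _ 0) (preservesSectors_numberOp _ 1)).ite _

/-- **Every term of the grand-canonical `t–t'` Hubbard interaction preserves the `(N↑, N↓)` sectors.** [cite: LiebPRL1989, eqs. (1)–(2)] -/
theorem preservesSectors_gcInteractionTT' (t t' U μ hz : ℝ) (Z : Finset (Site 2)) :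
    PreservesSectors ((gcInteractionTT' t t' U μ hz).Φ Z) := by
  rw [gcInteractionTT', FermionInteraction.linearFamily_apply, hubbardTTPrimeFermionInteraction_apply, Fin.sum_univ_two]
  simp only [Matrix.cons_val_zero, Matrix.cons_val_one]
  exact ((preservesSectors_hubbardFermionInteraction t U Z).add (preservesSectors_diagHoppingFermionInteraction t' Z)).add
    (((preservesSectors_numberInteraction Z).smul _).add ((preservesSectors_spinImbalanceInteraction Z).smul _))

/-- **The `t–t'` interaction conserves the particle number, term by term**: `N_Z Φ(Z) = Φ(Z) N_Z`. [cite: LiebPRL1989, eqs. (1)–(2)] -/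
theorem commute_chargeSum_numberCharge_gcInteractionTT' (t t' U μ hz : ℝ) (Z : Finset (Site 2)) :
    Commute (chargeSum (numberCharge 2) Z) ((gcInteractionTT' t t' U μ hz).Φ Z) := by
  rw [chargeSum_numberCharge, totalNumber_eq_diagonal]
  exact ((preservesSectors_gcInteractionTT' t t' U μ hz Z).commute_diagonal fun a b => ((a + b : ℕ) : ℂ)).symm

/-- **The `t–t'` interaction conserves the spin imbalance, term by term**: `M_Z Φ(Z) = Φ(Z) M_Z`. [cite: LiebPRL1989, eqs. (1)–(2)] -/
theorem commute_chargeSum_spinCharge_gcInteractionTT' (t t' U μ hz : ℝ) (Z : Finset (Site 2)) :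
    Commute (chargeSum (spinCharge 2) Z) ((gcInteractionTT' t t' U μ hz).Φ Z) := by
  have h2 : (spinImbalance : FermionOp Z) = (2 : ℂ) • HubbardWave0.spinZ := by
    rw [HubbardWave0.spinZ, smul_smul, show (2 : ℂ) * (1 / 2) = 1 by norm_num, one_smul, spinImbalance]
  rw [chargeSum_spinCharge, h2, spinZ_eq_diagonal]
  exact (((preservesSectors_gcInteractionTT' t t' U μ hz Z).commute_diagonal fun a b => (1 / 2 : ℂ) * ((a : ℂ) - (b : ℂ))).symm).smul_left _

/-! ### §3 No `U(1)` breaking in any translation-invariant equilibrium state of the 2D `t–t'` Hubbard model -/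

section Hubbard

variable (t t' U μ hz : ℝ) {β : ℝ} (hβ : 0 ≤ β) {ω : InfVolFermionState 2}
include hβ

/-- **MERMIN–WAGNER FOR THE 2D `t–t'` HUBBARD MODEL, particle number**: for every `β ≥ 0`, every translation-invariant state `ω`
solving the variational principle of `gcInteractionTT' t t' U μ h` (`S(ω_{[0,n)²})/n² → P_free + β e(ω)`) and every local `O ∈ 𝔄_Λ`
with `N_Λ O − O N_Λ = κO`, `κ ≠ 0`: `ω(O) = 0`. [cite: KleinLandauShucker1981] [cite: KomaTasakiPRL1992, p. 3] -/
theorem InfVolFermionState.IsTranslationInvariant.expect_eq_zero_of_numberCharged_ttPrime (hω : ω.IsTranslationInvariant)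
    (hS : Tendsto (fun n : ℕ => vonNeumannEntropy (ω.rdm (halfOpenBox 2 n)) / ((n : ℝ) ^ 2)) atTop
      (𝓝 ((gcInteractionTT' t t' U μ hz).freePressure β + β * ω.meanEnergy (gcInteractionTT' t t' U μ hz) 1)))
    {Λ : Finset (Site 2)} (O : FermionOp Λ) {κ : ℂ} (hκ : κ ≠ 0)
    (hO : (totalNumber : FermionOp Λ) * O - O * totalNumber = κ • O) : ω.expect Λ O = 0 :=
  hω.expect_eq_zero_of_conservedCharge_two (gcInteractionTT'_isHermitian t t' U μ hz) (gcInteractionTT'_isEven t t' U μ hz)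
    (gcInteractionTT'_isTranslationInvariant t t' U μ hz) (gcInteractionTT'_hasFiniteRange t t' U μ hz) hβ hS
    (numberCharge_isHermitian 2) (parityAut_numberCharge 2) (commute_chargeSum_numberCharge_gcInteractionTT' t t' U μ hz) O hκ
    (by rw [chargeSum_numberCharge]; exact hO)

/-- **MERMIN–WAGNER FOR THE 2D `t–t'` HUBBARD MODEL, spin rotations about `z`**: `ω(O) = 0` for every local `O` with
`(N↑_Λ − N↓_Λ) O − O (N↑_Λ − N↓_Λ) = κO`, `κ ≠ 0` (e.g. `S^±_x`, `c_{x↑}c_{y↑}`). [cite: KleinLandauShucker1981] [cite: KomaTasakiPRL1992, p. 3] -/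
theorem InfVolFermionState.IsTranslationInvariant.expect_eq_zero_of_spinCharged_ttPrime (hω : ω.IsTranslationInvariant)
    (hS : Tendsto (fun n : ℕ => vonNeumannEntropy (ω.rdm (halfOpenBox 2 n)) / ((n : ℝ) ^ 2)) atTop
      (𝓝 ((gcInteractionTT' t t' U μ hz).freePressure β + β * ω.meanEnergy (gcInteractionTT' t t' U μ hz) 1)))
    {Λ : Finset (Site 2)} (O : FermionOp Λ) {κ : ℂ} (hκ : κ ≠ 0)
    (hO : (spinImbalance : FermionOp Λ) * O - O * spinImbalance = κ • O) : ω.expect Λ O = 0 :=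
  hω.expect_eq_zero_of_conservedCharge_two (gcInteractionTT'_isHermitian t t' U μ hz) (gcInteractionTT'_isEven t t' U μ hz)
    (gcInteractionTT'_isTranslationInvariant t t' U μ hz) (gcInteractionTT'_hasFiniteRange t t' U μ hz) hβ hS
    (spinCharge_isHermitian 2) (parityAut_spinCharge 2) (commute_chargeSum_spinCharge_gcInteractionTT' t t' U μ hz) O hκ
    (by rw [chargeSum_spinCharge]; exact hO)

/-- **NO PAIRING AMPLITUDE IN ANY TRANSLATION-INVARIANT EQUILIBRIUM STATE OF THE 2D `t–t'` HUBBARD MODEL, AT ANY TEMPERATURE**: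
`ω(c_p c_q) = 0` for all orbitals `p, q` of every finite region (the pair annihilator has charge `−2`:
`N c_p c_q − c_p c_q N = −2 c_p c_q`); in particular every component `ω(c_{x↑} c_{y↓})` of the `s`-, `d`- or any other pair field
vanishes. [cite: KleinLandauShucker1981] [cite: KomaTasakiPRL1992, p. 3] -/
theorem InfVolFermionState.IsTranslationInvariant.expect_annihilation_mul_annihilation_eq_zero_ttPrime (hω : ω.IsTranslationInvariant)
    (hS : Tendsto (fun n : ℕ => vonNeumannEntropy (ω.rdm (halfOpenBox 2 n)) / ((n : ℝ) ^ 2)) atTop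
      (𝓝 ((gcInteractionTT' t t' U μ hz).freePressure β + β * ω.meanEnergy (gcInteractionTT' t t' U μ hz) 1)))
    {Λ : Finset (Site 2)} (p q : Orb (PolySite Λ)) : ω.expect Λ (annihilation p * annihilation q) = 0 :=
  hω.expect_eq_zero_of_numberCharged_ttPrime t t' U μ hz hβ hS _ (by norm_num : (-2 : ℂ) ≠ 0)
    (totalNumber_commutator_annihilation_mul_annihilation p q)

/-- **Equilibrium-state form**: every translation-invariant equilibrium state (`IsVarEquilibrium β (gcInteractionTT' …) 1`) of the
2D `t–t'` Hubbard model annihilates every local observable of nonzero particle number. [cite: KleinLandauShucker1981] -/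
theorem InfVolFermionState.IsVarEquilibrium.expect_eq_zero_of_numberCharged_ttPrime (h : ω.IsVarEquilibrium β (gcInteractionTT' t t' U μ hz) 1)
    {Λ : Finset (Site 2)} (O : FermionOp Λ) {κ : ℂ} (hκ : κ ≠ 0)
    (hO : (totalNumber : FermionOp Λ) * O - O * totalNumber = κ • O) : ω.expect Λ O = 0 :=
  h.1.expect_eq_zero_of_numberCharged_ttPrime t t' U μ hz hβ
    (h.tendsto_boxEntropy_div two_pos (gcInteractionTT'_isHermitian t t' U μ hz) (gcInteractionTT'_isEven t t' U μ hz)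
      (gcInteractionTT'_isTranslationInvariant t t' U μ hz) (gcInteractionTT'_hasFiniteRange t t' U μ hz) hβ) O hκ hO

/-- **Equilibrium-state form, spin**: `ω(O) = 0` for every local `O` of nonzero spin imbalance. [cite: KleinLandauShucker1981] -/
theorem InfVolFermionState.IsVarEquilibrium.expect_eq_zero_of_spinCharged_ttPrime (h : ω.IsVarEquilibrium β (gcInteractionTT' t t' U μ hz) 1)
    {Λ : Finset (Site 2)} (O : FermionOp Λ) {κ : ℂ} (hκ : κ ≠ 0)
    (hO : (spinImbalance : FermionOp Λ) * O - O * spinImbalance = κ • O) : ω.expect Λ O = 0 :=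
  h.1.expect_eq_zero_of_spinCharged_ttPrime t t' U μ hz hβ
    (h.tendsto_boxEntropy_div two_pos (gcInteractionTT'_isHermitian t t' U μ hz) (gcInteractionTT'_isEven t t' U μ hz)
      (gcInteractionTT'_isTranslationInvariant t t' U μ hz) (gcInteractionTT'_hasFiniteRange t t' U μ hz) hβ) O hκ hO

/-- **Equilibrium-state form, pairs**: `ω(c_p c_q) = 0` in every translation-invariant equilibrium state of the 2D `t–t'` Hubbard model,
at every `β ≥ 0`. [cite: KleinLandauShucker1981] [cite: KomaTasakiPRL1992, p. 3] -/
theorem InfVolFermionState.IsVarEquilibrium.expect_annihilation_mul_annihilation_eq_zero_ttPrime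
    (h : ω.IsVarEquilibrium β (gcInteractionTT' t t' U μ hz) 1) {Λ : Finset (Site 2)} (p q : Orb (PolySite Λ)) :
    ω.expect Λ (annihilation p * annihilation q) = 0 :=
  h.expect_eq_zero_of_numberCharged_ttPrime t t' U μ hz hβ _ (by norm_num : (-2 : ℂ) ≠ 0)
    (totalNumber_commutator_annihilation_mul_annihilation p q)

end Hubbard

end Literature.MathematicalPhysics.QuantumLattice

end
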